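import Summits.Ventures.YMGap.FlowData.RectTubeOffsetLines
import HarnessLib

/-!
# Venture YMGap, track Y3 FLOW-DATA — the TRANSVERSE-MOMENTUM-π TORELON STATE on a rectangular tube: no
# `(ê_μ, π_ν)` sector (`ν ≠ μ`, `Ls ν` even) is annihilated, and `Δ_p = E_{ê_μ}^{π_ν} − E_{ê_μ} ≥ 0` HYPOTHESIS-FREE for
# `SU(2)` at every `β ≠ 0` (theorems only)

HONEST FRAMING: venture file of the cell `pub-ymgap` (QuantumFields programme), track Y3; companion THEOREMS for the
definitions of `FlowData/RectTubeTranslations.lean` (`rectMomentumPiOp`, `rectTubeFluxMomentumPiNorm`,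
`su2RectFluxMomentumPiEnergy` = the FLOW-TABLE's `E_y^π`).  Finite rectangular torus `Π_i ℤ/(Ls i)`; no number, no row,
nothing about `L → ∞`, the continuum or a mass gap.

THE WITNESS (alternating multi-line state).  For an axis `μ`, a transverse axis `ν ≠ μ` and `j ∈ ℤ/(Ls ν)` let `W_j` be
the holonomy trace of the straight `μ`-line at transverse offset `j ê_ν` and `W̃ = Σ_j (−1)^j W_j`.  Then
`ψ = e^{−J mag/2} W̃` is gauge-built, a twist eigenfunction with eigenvalues `χ_{ê_μ}(s)`, and — for EVEN `Ls ν`, where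
`(−1)^j` is a character — a translation eigenfunction `U_{iê_ν} ψ = (−1)^i ψ`; so `P_{ê_μ} ψ = ψ = Π_ν ψ`.  Its matrix
element is `⟪ψ, Tψ⟫ = c₀^{N−Ls μ} λ^{Ls μ} ∫ W̃²` (`inner_rectTubeTransferOperator_reproducingState`: the temporal links
gauge away and each line reproduces itself under the Haar chain with the SAME factor), and `∫ W̃² > 0` because
`W̃ ≠ 0` at the configuration with `z` on one link of the line `j = 0` (`Σ_j (−1)^j = 0` for even `Ls ν`).

(File 1/2, `FlowData/RectTubeOffsetLines.lean`: the offset-line algebra, `Σ_j (−1)^j = 0`, and the matrix element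
`inner_rectTubeTransferOperator_reproducingState`.)
* **`rectTubeFluxMomentumPiNorm_single_pos_of_schurScalar`** — `0 < ‖T ∘ P_{ê_μ} ∘ Π_ν‖` (any compact `G`, continuous `ρ`
  with `ρ(z) = −1`, `z` central, non-zero Schur scalar, `ν ≠ μ`, `Ls ν` even);
* **`su2_rectFluxMomentumPiNorm_single_pos`**, **`su2RectTorelonEnergy_le_fluxMomentumPiEnergy`** — for `SU(2)`, every
  `β ≠ 0`: the sector is not annihilated and **`E_{ê_μ} ≤ E_{ê_μ}^{π_ν}`**, i.e. the table's `Δ_p ≥ 0` on the `2×1×1`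
  tube (`μ = y`, `ν = x`, `Ls x = 2`), hypothesis-free.

References: G. 't Hooft, Nucl. Phys. B 153 (1979) 141 [cite: tHooft1979Flux]; M. Lüscher, Commun. Math. Phys. 54 (1977)
283 [cite: Luscher1977]; I. Montvay, G. Münster (1994) §3.2.6 [cite: MontvayMunster1994, §3.2.6].
-/

noncomputable section

open scoped BigOperators ENNReal
open MeasureTheory Filter Function
open Literature.MathematicalPhysics.QuantumFieldTheory Literature.Analysis.OperatorTheory
open Literature.MathematicalPhysics.QuantumLattice (RectTorusSite)

namespace Summit.Ventures.YMGap.FlowData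

/-! ### The alternating multi-line state and the non-annihilation of the `(ê_μ, π_ν)` sector -/

section MomentumState

variable {G : Type*} [Group G] [TopologicalSpace G] [IsTopologicalGroup G] [CompactSpace G]
  [MeasurableSpace G] [BorelSpace G] [SecondCountableTopology G] {n k : ℕ} (ρ : G →* Matrix (Fin n) (Fin n) ℂ)
  (J : ℝ) {Ls : Fin k → ℕ} [∀ i, NeZero (Ls i)]

/-- **The alternating multi-line witness of the `(ê_μ, π_ν)` sector** (`ν ≠ μ`, `Ls ν` even; continuous `ρ` with
`ρ(z) = −1`, `z` central, `n ≠ 0`): a continuous `W̃ = Σ_j (−1)^j W_j` such that `ψ = e^{−J mag/2} W̃` satisfies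
`P_{ê_μ} ψ = ψ`, `Π_ν ψ = ψ`, `⟪ψ, Tψ⟫ = c₀^{N−Ls μ} λ^{Ls μ} ∫ W̃²` (`λ` the Schur scalar of the one-link weight) and
`∫ W̃² > 0`. [cite: tHooft1979Flux] [cite: Luscher1977] -/
theorem exists_rectMomentumPiWitness (hρ : Continuous ρ) (hn : n ≠ 0) {z : G}
    (hz : z ∈ Subgroup.center G) (hρz : ρ z = -1) {lam : ℝ}
    (hM : ∀ i j, ∫ c, (Real.exp (J * (ρ c).trace.re) : ℂ) * ρ c i j ∂haarProbability G = if i = j then (lam : ℂ) else 0)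
    {μ ν : Fin k} (hμν : μ ≠ ν) (hν : Even (Ls ν)) :
    ∃ W : RectSlice Ls G → ℝ, Continuous W ∧
      ∃ hmem : MemLp (fun b : RectSlice Ls G => Real.exp (-(J / 2 * rectMagSum (Ls := Ls) ρ b)) * W b) 2
          (rectSliceMeasure G Ls),
        rectTubeFluxProjection z Ls (Pi.single μ 1) (hmem.toLp _) = hmem.toLp _ ∧
        rectMomentumPiOp Ls ν (hmem.toLp _) = hmem.toLp _ ∧
        @inner ℝ _ _ (hmem.toLp _) (rectTubeTransferOperator ρ J Ls (hmem.toLp _)) =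
          (∫ g, Real.exp (J * (ρ g).trace.re) ∂haarProbability G) ^ (Fintype.card (RectTorusSite Ls × Fin k) - Ls μ) *
            lam ^ (Ls μ) * ∫ b, W b ^ 2 ∂(rectSliceMeasure G Ls) ∧
        0 < ∫ b, W b ^ 2 ∂(rectSliceMeasure G Ls) := by
  classical
  -- the lines, their traces, the alternating sum
  set ℓ : ZMod (Ls ν) → Fin (Ls μ) → RectTorusSite Ls × Fin k :=
    fun j t => (Pi.single μ ((t : ℕ) : ZMod (Ls μ)) + Pi.single ν j, μ) with hℓ
  set Wj : ZMod (Ls ν) → RectSlice Ls G → ℝ :=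
    fun j b => (ρ ((List.ofFn fun t : Fin (Ls μ) => b (ℓ j t)).prod)).trace.re with hWj
  set W : RectSlice Ls G → ℝ := fun b => ∑ j : ZMod (Ls ν), zmodParitySign j * Wj j b with hW
  set f : RectSlice Ls G → ℝ := fun b => Real.exp (-(J / 2 * rectMagSum (Ls := Ls) ρ b)) * W b with hf
  set C : ℝ := (∫ g, Real.exp (J * (ρ g).trace.re) ∂haarProbability G) ^ (Fintype.card (RectTorusSite Ls × Fin k) - Ls μ) *
    lam ^ (Ls μ) with hC
  have hWjc : ∀ j, Continuous (Wj j) := fun j =>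
    Complex.continuous_re.comp ((hρ.comp (continuous_prod_ofFn_apply (Ls μ) (ℓ j))).matrix_trace)
  have hWc : Continuous W := continuous_finsetSum _ fun j _ => continuous_const.mul (hWjc j)
  have hfc : Continuous f :=
    (Real.continuous_exp.comp (continuous_const.mul (continuous_rectMagSum (Ls := Ls) ρ hρ)).neg).mul hWc
  obtain ⟨Cf, hCf⟩ := isCompact_univ.exists_bound_of_continuousOn hfc.continuousOn
  have hmem : MemLp f 2 (rectSliceMeasure G Ls) :=
    MemLp.of_bound hfc.aestronglyMeasurable Cf (Eventually.of_forall fun b => hCf b (Set.mem_univ _))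
  -- gauge invariance of each line trace, hence of `W`
  have hWjg : ∀ j (γ : RectTorusSite Ls → G) (b : RectSlice Ls G),
      Wj j (fun e => γ e.1 * b e * (γ (e.1 + Pi.single e.2 1))⁻¹) = Wj j b := by
    intro j γ b
    simp only [hWj, hℓ]
    rw [prod_ofFn_rectOffsetLine_gauge, map_mul, map_mul, Matrix.trace_mul_cycle, ← map_mul, inv_mul_cancel, map_one,
      one_mul]
  have hWg : ∀ (γ : RectTorusSite Ls → G) (b : RectSlice Ls G),
      W (fun e => γ e.1 * b e * (γ (e.1 + Pi.single e.2 1))⁻¹) = W b := by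
    intro γ b
    simp only [hW, hWjg]
  -- the reproducing property: each line reproduces itself with the same factor `C`
  have hw : Continuous fun g : G => Real.exp (J * (ρ g).trace.re) :=
    Real.continuous_exp.comp (continuous_const.mul (Complex.continuous_re.comp hρ.matrix_trace))
  have hrepj : ∀ j (a : RectSlice Ls G),
      ∫ c, (∏ e : RectTorusSite Ls × Fin k, Real.exp (J * (ρ (c e)).trace.re)) * Wj j (c * a) ∂(rectSliceMeasure G Ls) =
        C * Wj j a := by
    intro j a
    have h4 : ∀ c : RectSlice Ls G, Wj j (c * a) =
        ((1 : Matrix (Fin n) (Fin n) ℂ) * ρ ((List.ofFn fun t : Fin (Ls μ) => c (ℓ j t) * a (ℓ j t)).prod) * 1).trace.re := by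
      intro c
      simp only [hWj, Pi.mul_apply, one_mul, mul_one]
    simp_rw [h4]
    rw [integral_prod_weight_mul_re_trace_rectLine ρ (w := fun g : G => Real.exp (J * (ρ g).trace.re)) hw hρ hM (ℓ j)
      (rectOffsetLine_injective hμν j) (fun t => a (ℓ j t)) 1 1]
    simp only [hC, hWj, one_mul, mul_one]
  have hrep : ∀ a : RectSlice Ls G,
      ∫ c, (∏ e : RectTorusSite Ls × Fin k, Real.exp (J * (ρ (c e)).trace.re)) * W (c * a) ∂(rectSliceMeasure G Ls) =
        C * W a := by
    intro a
    have hint : ∀ j, Integrable (fun c : RectSlice Ls G => zmodParitySign j *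
        ((∏ e : RectTorusSite Ls × Fin k, Real.exp (J * (ρ (c e)).trace.re)) * Wj j (c * a)))
        (rectSliceMeasure G Ls) := fun j =>
      (continuous_const.mul ((continuous_finsetProd _ fun e _ => hw.comp (continuous_apply e)).mul
        ((hWjc j).comp (continuous_id.mul continuous_const)))).integrable_of_hasCompactSupport
        (HasCompactSupport.of_compactSpace _)
    simp only [hW]
    have h1 : (fun c : RectSlice Ls G => (∏ e : RectTorusSite Ls × Fin k, Real.exp (J * (ρ (c e)).trace.re)) *
        ∑ j : ZMod (Ls ν), zmodParitySign j * Wj j (c * a)) =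
        fun c => ∑ j : ZMod (Ls ν), zmodParitySign j *
          ((∏ e : RectTorusSite Ls × Fin k, Real.exp (J * (ρ (c e)).trace.re)) * Wj j (c * a)) := by
      funext c
      rw [Finset.mul_sum Finset.univ (fun j => zmodParitySign j * Wj j (c * a))]
      exact Finset.sum_congr rfl fun j _ => by ring
    rw [h1, integral_finsetSum Finset.univ (fun j _ => hint j),
      Finset.mul_sum Finset.univ (fun j => zmodParitySign j * Wj j a) C]
    refine Finset.sum_congr rfl fun j _ => ?_
    rw [integral_const_mul, hrepj j a]
    ring
  have hinner := inner_rectTubeTransferOperator_reproducingState ρ J hρ hWc hWg hrep hmem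
  -- `ψ` lies in the sector: twist eigenvalues `χ_{ê_μ}(s)`
  have hsign : ∀ s : Fin k → ZMod 2, fluxSign (Pi.single μ 1 : Fin k → ZMod 2) s = if s μ = 1 then -1 else 1 := by
    intro s
    unfold fluxSign
    rw [Finset.prod_eq_single μ]
    · simp only [Pi.single_eq_same, true_and]
    · intro ν' _ hν'
      simp only [Pi.single_apply, if_neg hν', zero_ne_one, false_and, if_false]
    · intro h; exact absurd (Finset.mem_univ μ) h
  have hWjs : ∀ j (s : Fin k → ZMod 2) (b : RectSlice Ls G),
      Wj j (rectFluxTwist z s b) = fluxSign (Pi.single μ 1 : Fin k → ZMod 2) s * Wj j b := by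
    intro j s b
    simp only [hWj, hℓ]
    rw [prod_ofFn_rectOffsetLine_fluxTwist hμν, map_mul, hsign]
    split_ifs with h
    · rw [hρz, neg_mul, one_mul, Matrix.trace_neg, Complex.neg_re, neg_mul, one_mul]
    · rw [map_one, one_mul, one_mul]
  have heig : ∀ s : Fin k → ZMod 2,
      rectFluxTwistOp Ls z s (hmem.toLp f) = fluxSign (Pi.single μ 1 : Fin k → ZMod 2) s • hmem.toLp f := by
    intro s
    refine rectFluxTwistOp_toLp_eq_smul z s hmem _ fun b => ?_
    simp only [hf, hW]
    rw [rectMagSum_fluxTwist ρ hz]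
    simp_rw [hWjs]
    have hs : ∑ j : ZMod (Ls ν), zmodParitySign j * (fluxSign (Pi.single μ 1 : Fin k → ZMod 2) s * Wj j b) =
        fluxSign (Pi.single μ 1 : Fin k → ZMod 2) s * ∑ j : ZMod (Ls ν), zmodParitySign j * Wj j b := by
      rw [Finset.mul_sum Finset.univ (fun j => zmodParitySign j * Wj j b)]
      exact Finset.sum_congr rfl fun j _ => by ring
    rw [hs]
    ring
  have hP : rectTubeFluxProjection z Ls (Pi.single μ 1) (hmem.toLp f) = hmem.toLp f :=
    rectTubeFluxProjection_apply_of_twist_eigen z heig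
  -- `ψ` has momentum `π` along `ν`: `U_{iê_ν} ψ = (−1)^i ψ`
  have hWt : ∀ (i : ZMod (Ls ν)) (b : RectSlice Ls G), W (rectTranslate (Pi.single ν i) b) = zmodParitySign i * W b := by
    intro i b
    simp only [hW, hWj, hℓ]
    simp_rw [prod_ofFn_rectOffsetLine_translate]
    rw [Finset.mul_sum]
    conv_rhs => rw [← Equiv.sum_comp (Equiv.addRight i)]
    refine Finset.sum_congr rfl fun x _ => ?_
    simp only [Equiv.coe_addRight]
    have hx : zmodParitySign x = zmodParitySign i * zmodParitySign (x + i) := by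
      rw [zmodParitySign_add hν, mul_comm (zmodParitySign x) (zmodParitySign i), ← mul_assoc,
        zmodParitySign_mul_self, one_mul]
    rw [hx]
    ring
  have hU : ∀ i : ZMod (Ls ν),
      rectTranslateOp Ls (Pi.single ν i : RectTorusSite Ls) (hmem.toLp f) = zmodParitySign i • hmem.toLp f := by
    intro i
    rw [rectTranslateOp_toLp]
    apply Lp.ext
    have h1 := (hmem.comp_measurePreserving (measurePreserving_rectTranslate (G := G) (Ls := Ls) (Pi.single ν i))).coeFn_toLp
    have h3 : (f ∘ rectTranslate (G := G) (Ls := Ls) (Pi.single ν i)) = fun b => zmodParitySign i * f b := by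
      funext b
      simp only [Function.comp_apply, hf]
      rw [rectMagSum_translate, hWt]
      ring
    filter_upwards [h1, Lp.coeFn_smul (zmodParitySign i) (hmem.toLp f), hmem.coeFn_toLp] with b hb1 hb2 hb3
    rw [hb1, h3, hb2, Pi.smul_apply, hb3, smul_eq_mul]
  have hPi : rectMomentumPiOp Ls ν (hmem.toLp f) = hmem.toLp f := rectMomentumPiOp_apply_of_eigen ν hU
  -- positivity of the matrix element
  -- `W ≠ 0` at the configuration with `z` on the first link of the line `j = 0`
  have hLν : 2 ≤ Ls ν := by
    obtain ⟨r, hr⟩ := hν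
    have h0 : Ls ν ≠ 0 := NeZero.ne _
    omega
  set a0 : RectSlice Ls G := fun e => if e = ℓ 0 ⟨0, Nat.pos_of_ne_zero (NeZero.ne (Ls μ))⟩ then z else 1 with ha0
  have hline0 : Wj 0 a0 = -n := by
    have hprod : (List.ofFn fun t : Fin (Ls μ) => a0 (ℓ 0 t)).prod =
        (List.ofFn fun t : Fin (Ls μ) => (if (t : ℕ) = 0 then z else 1)).prod := by
      have hfun : (fun t : Fin (Ls μ) => a0 (ℓ 0 t)) = fun t : Fin (Ls μ) => (if (t : ℕ) = 0 then z else 1) := by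
        funext t
        simp only [ha0]
        have : (ℓ 0 t = ℓ 0 ⟨0, Nat.pos_of_ne_zero (NeZero.ne (Ls μ))⟩) ↔ ((t : ℕ) = 0) := by
          constructor
          · intro h; have := rectOffsetLine_injective (Ls := Ls) hμν 0 h; exact congrArg Fin.val this
          · intro h
            have ht : t = ⟨0, Nat.pos_of_ne_zero (NeZero.ne (Ls μ))⟩ := Fin.ext h
            rw [ht]
        simp only [this]
      rw [hfun]
    have hprod' : (List.ofFn fun t : Fin (Ls μ) => (if (t : ℕ) = 0 then z else (1 : G))).prod = z := by
      have h := prod_ofFn_ite_zero_mul (Ls μ) z True (fun _ => (1 : G))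
      simp only [true_and, if_true, List.ofFn_const, List.prod_replicate, one_pow, mul_one] at h
      exact h
    simp only [hWj]
    rw [hprod, hprod', hρz, Matrix.trace_neg, Matrix.trace_one, Complex.neg_re, Fintype.card_fin, Complex.natCast_re]
  have hlinej : ∀ j : ZMod (Ls ν), j ≠ 0 → Wj j a0 = n := by
    intro j hj
    have hprod : (List.ofFn fun t : Fin (Ls μ) => a0 (ℓ j t)).prod = 1 := by
      have : (fun t : Fin (Ls μ) => a0 (ℓ j t)) = fun _ => 1 := by
        funext t
        simp only [ha0]
        rw [if_neg]
        intro h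
        have h2 := congrArg (fun e : RectTorusSite Ls × Fin k => e.1 ν) h
        simp only [hℓ, Pi.add_apply, Pi.single_eq_same, Pi.single_eq_of_ne (Ne.symm hμν), zero_add] at h2
        exact hj h2
      rw [this, List.ofFn_const, List.prod_replicate, one_pow]
    simp only [hWj]
    rw [hprod, map_one, Matrix.trace_one, Fintype.card_fin, Complex.natCast_re]
  have hWa0 : W a0 = -(2 * n) := by
    simp only [hW]
    rw [← Finset.add_sum_erase _ _ (Finset.mem_univ (0 : ZMod (Ls ν))), zmodParitySign_zero, one_mul, hline0]
    have hrest : ∑ j ∈ Finset.univ.erase (0 : ZMod (Ls ν)), zmodParitySign j * Wj j a0 =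
        (n : ℝ) * ∑ j ∈ Finset.univ.erase (0 : ZMod (Ls ν)), zmodParitySign j := by
      rw [Finset.mul_sum]
      refine Finset.sum_congr rfl fun j hj => ?_
      rw [hlinej j (Finset.ne_of_mem_erase hj), mul_comm]
    have hsum0 := sum_zmodParitySign_eq_zero hν hLν
    rw [← Finset.add_sum_erase _ _ (Finset.mem_univ (0 : ZMod (Ls ν))), zmodParitySign_zero] at hsum0
    rw [hrest]
    have : ∑ j ∈ Finset.univ.erase (0 : ZMod (Ls ν)), zmodParitySign j = -1 := by linarith
    rw [this]
    ring
  have hW2 : 0 < ∫ b, W b ^ 2 ∂(rectSliceMeasure G Ls) := by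
    refine Continuous.integral_pos_of_hasCompactSupport_nonneg_nonzero (x := a0) (hWc.pow 2)
      (HasCompactSupport.of_compactSpace _) (fun b => sq_nonneg _) ?_
    rw [hWa0]
    exact pow_ne_zero 2 (neg_ne_zero.2 (mul_ne_zero two_ne_zero (Nat.cast_ne_zero.2 hn)))
  exact ⟨W, hWc, hmem, hP, hPi, hinner, hW2⟩

/-- **No `(ê_μ, π_ν)` sector is annihilated** (general compact group): for continuous `ρ` with `ρ(z) = −1`, `z` central,
`n ≠ 0`, a non-zero Schur scalar `λ` of the one-link weight, `ν ≠ μ` and `Ls ν` even, `0 < ‖T ∘ P_{ê_μ} ∘ Π_ν‖` — the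
alternating multi-line state `e^{−J mag/2} Σ_j (−1)^j W_j` is the witness. [cite: tHooft1979Flux] [cite: Luscher1977] -/
theorem rectTubeFluxMomentumPiNorm_single_pos_of_schurScalar (hρ : Continuous ρ) (hn : n ≠ 0) {z : G}
    (hz : z ∈ Subgroup.center G) (hρz : ρ z = -1) {lam : ℝ} (hlam : lam ≠ 0)
    (hM : ∀ i j, ∫ c, (Real.exp (J * (ρ c).trace.re) : ℂ) * ρ c i j ∂haarProbability G = if i = j then (lam : ℂ) else 0)
    {μ ν : Fin k} (hμν : μ ≠ ν) (hν : Even (Ls ν)) :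
    0 < rectTubeFluxMomentumPiNorm ρ z J Ls (Pi.single μ 1) ν := by
  obtain ⟨W, hWc, hmem, hP, hPi, hinner, hW2⟩ := exists_rectMomentumPiWitness ρ J hρ hn hz hρz hM hμν hν
  have hw : Continuous fun g : G => Real.exp (J * (ρ g).trace.re) :=
    Real.continuous_exp.comp (continuous_const.mul (Complex.continuous_re.comp hρ.matrix_trace))
  have hc0 : 0 < ∫ g, Real.exp (J * (ρ g).trace.re) ∂haarProbability G :=
    integral_exp_pos (hw.integrable_of_hasCompactSupport (HasCompactSupport.of_compactSpace _))
  have hne : @inner ℝ _ _ (hmem.toLp _) (rectTubeTransferOperator ρ J Ls (hmem.toLp _)) ≠ 0 := by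
    rw [hinner]
    exact mul_ne_zero (mul_ne_zero (pow_ne_zero _ hc0.ne') (pow_ne_zero _ hlam)) hW2.ne'
  unfold rectTubeFluxMomentumPiNorm
  refine lt_of_le_of_ne (norm_nonneg _) fun h0 => hne ?_
  have hTP : (rectTubeTransferOperator ρ J Ls).comp
      ((rectTubeFluxProjection z Ls (Pi.single μ 1)).comp (rectMomentumPiOp Ls ν)) = 0 := norm_eq_zero.1 h0.symm
  have h := congrArg (fun A => A (hmem.toLp _)) hTP
  simp only [ContinuousLinearMap.comp_apply, hPi, hP, _root_.zero_apply] at h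
  rw [h, inner_zero_right]

end MomentumState

/-! ### The cell's object: `SU(2)`, `β ≠ 0` — `Δ_p ≥ 0` hypothesis-free -/

section SU2

open Literature.MathematicalPhysics.QuantumLattice (fundamentalRep continuous_fundamentalRep secondCountableTopology_su2)

/-- **No `(ê_μ, π_ν)` sector of the rectangular `SU(2)` tube is annihilated** (`ν ≠ μ`, `Ls ν` even, `β ≠ 0`):
`0 < su2RectFluxMomentumPiNorm β Ls ê_μ ν`. [cite: tHooft1979Flux] -/
theorem su2_rectFluxMomentumPiNorm_single_pos {k : ℕ} {β : ℝ} (hβ : β ≠ 0) (Ls : Fin k → ℕ) [∀ i, NeZero (Ls i)]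
    {μ ν : Fin k} (hμν : μ ≠ ν) (hν : Even (Ls ν)) :
    0 < su2RectFluxMomentumPiNorm β Ls (Pi.single μ 1) ν := by
  haveI : SecondCountableTopology (Matrix.specialUnitaryGroup (Fin 2) ℂ) := secondCountableTopology_su2
  exact rectTubeFluxMomentumPiNorm_single_pos_of_schurScalar (fundamentalRep (Fin 2)) (β / 2)
    (continuous_fundamentalRep (Fin 2)) two_ne_zero su2MinusOne_mem_center fundamentalRep_su2MinusOne
    (su2_schurScalar_ne_zero hβ) (su2_integral_exp_mul_apply (β / 2)) hμν hν

/-- **`Δ_p ≥ 0` HYPOTHESIS-FREE**: on every rectangular `SU(2)` tube, for every axis `μ`, every transverse axis `ν ≠ μ`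
with `Ls ν` even and every `β ≠ 0`, the torelon energy with transverse momentum `π` is at least the torelon energy:
`su2RectTorelonEnergy β Ls μ ≤ su2RectFluxMomentumPiEnergy β Ls ê_μ ν` (the FLOW-TABLE's `2×1×1` rows
`Δ_p = E_y^π − E_y ≥ 0`, `μ = y`, `ν = x`, `Ls x = 2`).  Finite volume only. [folklore] -/
theorem su2RectTorelonEnergy_le_fluxMomentumPiEnergy {k : ℕ} {β : ℝ} (hβ : β ≠ 0) (Ls : Fin k → ℕ)
    [∀ i, NeZero (Ls i)] {μ ν : Fin k} (hμν : μ ≠ ν) (hν : Even (Ls ν)) :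
    su2RectTorelonEnergy β Ls μ ≤ su2RectFluxMomentumPiEnergy β Ls (Pi.single μ 1) ν :=
  rectTubeFluxEnergy_le_fluxMomentumPiEnergy (fundamentalRep (Fin 2)) su2MinusOne (β / 2) Ls (Pi.single μ 1) ν
    (su2_rectFluxMomentumPiNorm_single_pos hβ Ls hμν hν)

end SU2

end Summit.Ventures.YMGap.FlowData
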